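import Mathlib.Analysis.SpecialFunctions.SmoothTransition
import Mathlib.Analysis.InnerProductSpace.Calculus
import Mathlib.Analysis.InnerProductSpace.PiL2
import HarnessLib

/-!
# Crux `SelfMixingDichotomy.CoherentScaleExclusion` (stmt-NavierStokesRegularity-1423), line `registered`:
# stub SW1 `stub_radialBump` — a radial bump datum

Support file (`--supports stmt-NavierStokesRegularity-1423`) of the line lead c3 for the amplitude-free
coherence package (sphere-tangential drifts never stir radial blobs). For `r > 0` the datum

  `θ₀ x = Real.smoothTransition ((r² − ‖x‖²) · (4 / (3 r²)))`

is `C^∞`, compactly supported, takes values in `[0, 1]`, equals `1` on `B̄(0, r/2)` (there the argument is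
`≥ 1`), is supported in `B(0, r)` (for `‖x‖ ≥ r` the argument is `≤ 0`), and is RADIAL: it depends on `x` only
through `‖x‖`. Only Mathlib is used.
-/

noncomputable section

open Metric Set Function

-- `Summit = Problem` for this summit; the tree lakefile sets `weak.linter.dupNamespace = false`.
set_option linter.dupNamespace false

namespace Summit.NavierStokesRegularity.NavierStokesRegularity.Theorems

/-- **SW1 — a radial bump datum** (registered sub-goal `stub_radialBump` of the crux `CoherentScaleExclusion`,
line `registered`, lead c3). For `r > 0` there is a `C^∞` compactly supported `θ₀ : ℝ³ → [0, 1]`, equal to `1`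
on `B̄(0, r/2)`, supported in `B(0, r)`, and radial (`‖x‖ = ‖y‖ ⇒ θ₀ x = θ₀ y`); explicitly
`θ₀ x = Real.smoothTransition ((r² − ‖x‖²) · (4 / (3 r²)))`. -/
theorem stub_radialBump :
    ∀ r : ℝ, 0 < r → ∃ θ₀ : EuclideanSpace ℝ (Fin 3) → ℝ,
      ContDiff ℝ (⊤ : ℕ∞) θ₀ ∧ HasCompactSupport θ₀ ∧
      (∀ x, 0 ≤ θ₀ x) ∧ (∀ x, θ₀ x ≤ 1) ∧
      (∀ x ∈ Metric.closedBall (0 : EuclideanSpace ℝ (Fin 3)) (r / 2), θ₀ x = 1) ∧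
      Function.support θ₀ ⊆ Metric.ball (0 : EuclideanSpace ℝ (Fin 3)) r ∧
      (∀ x y : EuclideanSpace ℝ (Fin 3), ‖x‖ = ‖y‖ → θ₀ x = θ₀ y) := by
  intro r hr
  have hr2 : 0 < r ^ 2 := by positivity
  refine ⟨fun x => Real.smoothTransition ((r ^ 2 - ‖x‖ ^ 2) * (4 / (3 * r ^ 2))), ?_, ?_, ?_, ?_, ?_, ?_, ?_⟩
  · -- smoothness
    exact Real.smoothTransition.contDiff.comp
      ((contDiff_const.sub (contDiff_norm_sq ℝ)).mul contDiff_const)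
  · -- compact support: the support lies in the closed ball of radius `r`
    refine HasCompactSupport.of_support_subset_isCompact (isCompact_closedBall (0 : EuclideanSpace ℝ (Fin 3)) r) ?_
    intro x hx
    rw [mem_closedBall, dist_zero_right]
    by_contra h
    push Not at h
    apply hx
    have hle : (r ^ 2 - ‖x‖ ^ 2) * (4 / (3 * r ^ 2)) ≤ 0 := by
      have : r ^ 2 ≤ ‖x‖ ^ 2 := by nlinarith [norm_nonneg x]
      exact mul_nonpos_of_nonpos_of_nonneg (by linarith) (by positivity)
    exact Real.smoothTransition.zero_of_nonpos hle
  · exact fun x => Real.smoothTransition.nonneg _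
  · exact fun x => Real.smoothTransition.le_one _
  · -- `= 1` on the closed half ball
    intro x hx
    rw [mem_closedBall, dist_zero_right] at hx
    have hx2 : ‖x‖ ^ 2 ≤ (r / 2) ^ 2 := pow_le_pow_left₀ (norm_nonneg _) hx 2
    apply Real.smoothTransition.one_of_one_le
    rw [← sub_nonneg]
    have h : (r ^ 2 - ‖x‖ ^ 2) * (4 / (3 * r ^ 2)) - 1 = (4 * (r ^ 2 - ‖x‖ ^ 2) - 3 * r ^ 2) / (3 * r ^ 2) := by
      field_simp
    rw [h]
    exact div_nonneg (by nlinarith) (by positivity)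
  · -- support inside the open ball
    intro x hx
    rw [mem_ball, dist_zero_right]
    by_contra h
    push Not at h
    apply hx
    have hle : (r ^ 2 - ‖x‖ ^ 2) * (4 / (3 * r ^ 2)) ≤ 0 := by
      have : r ^ 2 ≤ ‖x‖ ^ 2 := by nlinarith [norm_nonneg x]
      exact mul_nonpos_of_nonpos_of_nonneg (by linarith) (by positivity)
    exact Real.smoothTransition.zero_of_nonpos hle
  · -- radial
    intro x y hxy
    simp only [hxy]

end Summit.NavierStokesRegularity.NavierStokesRegularity.Theorems

end
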